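import Mathlib
import Summits.ResolutionOfSingularities.ResolutionOfSingularities.Theorems.RadicialJungCleanModelsCleanProp44FaceDegree
import HarnessLib

/-!
# Route `RadicialJung`, crux `CleanModels` (stmt-ResolutionOfSingularities-15917), line `Sketch` rev 35, stub 6 `stub_cleanProp44` (X44c):
# THE SOLVABLE FACE — a near successor through the `δ`-face forces `Φ = c·(T + λ(u))^μ` with `λ` a POLYNOMIAL, `deg λ ≤ δ` (census (iii-3) (c))

Seat decomp-res-hand-2 g20 (structural hand); sequel of ✓ `…CleanProp44LeafTowerStep.lean` (the `δ`-face `Φ = Σ_{e≤μ} t̄^e C_e(u)` modulo the exceptional parameter,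
`C_μ = c` a non-zero constant, `deg C_e ≤ (μ−e)δ`) and ✓ `…CleanProp44FaceDegree.lean`.  Memo 4e §2.5: «a near successor exists ⟺ `Σ_e t_m^e C_e = C_μ(t_m + λ(u₂′))^μ`
… with `Λ` a binary form of degree `δ` (so `deg λ ≤ δ`, `λ` a POLYNOMIAL by integral closedness) ⟺ the `δ`-face is SOLVABLE.  The successor is
`Γ″ = V(u₁, t_m + λ(u₂′))`».  In the chart of the last exceptional divisor `E ≅ Spec κ[t̄, u]` a curve `Γ″ ⊂ E` along which the transform keeps order `μ` is a
height-one prime `(π)` of `κ[u][t̄]` with `π^μ ∣ Φ`.  THIS FILE (pure polynomial algebra over a field, def-free):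

* `eq_C_mul_X_add_C_pow_of_pow_dvd` — **SOLVABILITY**: `Φ ∈ κ[u][T]` with `deg_T Φ ≤ μ` (`μ ≥ 1`) and top coefficient `Φ_μ = c ∈ κ^×` (a CONSTANT), `π` a non-unit
  with `π^μ ∣ Φ` ⟹ `π = a·(T + λ(u))` for some `a ∈ κ^×`, `λ ∈ κ[u]`, and `Φ = c·(T + λ)^μ`.  (Degrees in `T`: `deg_T π ≤ 1`; `deg_T π = 0` would make a non-unit
  of `κ[u]` divide the unit `c`; the leading coefficient `a^μ q₀ = c` makes `a` a unit of `κ[u]`, i.e. a constant — «`λ` is a polynomial».)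
* `natDegree_le_of_solvableFace` — with `deg C₀ ≤ μ·d` (`C₀ = Φ_0`, the weight bound of the face): `deg λ ≤ d` (✓ `natDegree_le_of_C_mul_pow_eq`).

So the successor line is `Γ″ = V(u₁, t̄ + λ(u))` with `deg λ ≤ δ`, and ✓ `sum_mul_natDegree_le_sub_two` (`…FaceDegree`) bounds its births by `δ − 2` once
`U|_{Γ″} = −v(c)·λ` is identified (NOT done here: (iii-3) (c) scheme side).  Honest framing: OURS, elementary; nothing here proves X44c, any case of `CleanModels`, or
resolution of singularities in characteristic `p`. [cite: CossartPiltant2008, Lemma 4.3 (4)–(5); Prop. 4.4 (proof, p. 11)] [cite: CossartJannsenSaito2020, Lemma 7.5]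
-/

noncomputable section

set_option linter.dupNamespace false -- mandated namespace of this single-conjunct summit

open Polynomial

namespace Summit.ResolutionOfSingularities.ResolutionOfSingularities.Theorems.RadicialJung.CleanModels

variable {k : Type*} [Field k]

/-- Units of `κ[u][T]` of `T`-degree `0` whose constant is a unit of `κ[u]`: a degree-zero `π = C π₀` dividing (to a positive power) a polynomial with a unit
coefficient is a unit. [folklore] -/
theorem isUnit_of_natDegree_eq_zero_of_pow_dvd {Φ π : (k[X])[X]} {μ : ℕ} (hμ : 1 ≤ μ) (hπ0 : π.natDegree = 0) (hdvd : π ^ μ ∣ Φ)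
    {n : ℕ} (hunit : IsUnit (Φ.coeff n)) : IsUnit π := by
  rw [eq_C_of_natDegree_eq_zero hπ0] at hdvd ⊢
  obtain ⟨q, hq⟩ := hdvd
  have h1 : Φ.coeff n = (π.coeff 0) ^ μ * q.coeff n := by
    rw [hq, ← C_pow, coeff_C_mul]
  rw [h1] at hunit
  have h2 : IsUnit (π.coeff 0 ^ μ) := isUnit_of_mul_isUnit_left hunit
  exact (isUnit_pow_iff (by omega)).mp h2 |>.map C

/-- **THE SOLVABLE FACE.**  `Φ ∈ κ[u][T]` with `deg_T Φ ≤ μ`, `1 ≤ μ`, top coefficient `Φ_μ = c` a non-zero CONSTANT; `π` a non-unit with `π^μ ∣ Φ`.  Then for some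
`a ∈ κ^×` and `λ ∈ κ[u]`: `π = a·(T + λ)` and `Φ = c·(T + λ)^μ`. [cite: CossartPiltant2008, Lemma 4.3 (5); Prop. 4.4 (proof, p. 11)] [cite: CossartJannsenSaito2020, Lemma 7.5] -/
theorem eq_C_mul_X_add_C_pow_of_pow_dvd {Φ π : (k[X])[X]} {μ : ℕ} (hμ : 1 ≤ μ) (hdeg : Φ.natDegree ≤ μ) {c : k} (hc : c ≠ 0)
    (htop : Φ.coeff μ = C c) (hπ : ¬ IsUnit π) (hdvd : π ^ μ ∣ Φ) :
    ∃ (a : k) (lam : k[X]), a ≠ 0 ∧ π = C (C a) * (X + C lam) ∧ Φ = C (C c) * (X + C lam) ^ μ := by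
  have hcu : IsUnit (C c : k[X]) := (isUnit_iff_ne_zero.mpr hc).map C
  have hΦμ : Φ.coeff μ ≠ 0 := by rw [htop]; exact hcu.ne_zero
  have hΦ0 : Φ ≠ 0 := fun h => hΦμ (by rw [h, coeff_zero])
  have hnat : Φ.natDegree = μ := le_antisymm hdeg (le_natDegree_of_ne_zero hΦμ)
  obtain ⟨q, hq⟩ := hdvd
  have hπ0 : π ≠ 0 := by
    rintro rfl; apply hΦ0; rw [hq, zero_pow (by omega), zero_mul]
  have hq0 : q ≠ 0 := by
    rintro rfl; apply hΦ0; rw [hq, mul_zero]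
  -- degrees in `T`: `μ = μ·deg π + deg q`
  have hdegs : μ = μ * π.natDegree + q.natDegree := by
    have h1 := congrArg natDegree hq
    rwa [natDegree_mul (pow_ne_zero _ hπ0) hq0, natDegree_pow, hnat] at h1
  have hπle : π.natDegree ≤ 1 := by
    by_contra h
    have : 2 ≤ π.natDegree := by omega
    have : μ * 2 ≤ μ * π.natDegree := Nat.mul_le_mul_left μ this
    omega
  rcases Nat.lt_or_ge π.natDegree 1 with hlt | hge
  · -- `deg_T π = 0`: `π` would be a unit
    exact absurd (isUnit_of_natDegree_eq_zero_of_pow_dvd hμ (by omega) ⟨q, hq⟩ (by rw [htop]; exact hcu)) hπ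
  · -- `deg_T π = 1`, `deg_T q = 0`
    have hπ1 : π.natDegree = 1 := le_antisymm hπle hge
    have hq1 : q.natDegree = 0 := by rw [hπ1, mul_one] at hdegs; omega
    have hqC : q = C (q.coeff 0) := eq_C_of_natDegree_eq_zero hq1
    -- leading coefficients: `lc(π)^μ · q₀ = c`
    have hlc : π.leadingCoeff ^ μ * q.coeff 0 = C c := by
      have h1 := congrArg leadingCoeff hq
      rw [leadingCoeff_mul, leadingCoeff_pow, hqC, leadingCoeff_C] at h1
      rw [← h1, leadingCoeff, hnat, htop]
    have hlcu : IsUnit π.leadingCoeff := by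
      have h2 : IsUnit (π.leadingCoeff ^ μ) := isUnit_of_mul_isUnit_left (by rw [hlc]; exact hcu)
      exact (isUnit_pow_iff (by omega)).mp h2
    obtain ⟨a, ha, haC⟩ := Polynomial.isUnit_iff.mp hlcu
    have ha0 : a ≠ 0 := ha.ne_zero
    -- `π = C(lc π)·T + C(π₀)`
    have hπeq : π = C π.leadingCoeff * X + C (π.coeff 0) := by
      have h1 := eq_X_add_C_of_natDegree_le_one hπle
      have h2 : π.leadingCoeff = π.coeff 1 := by rw [leadingCoeff, hπ1]
      rw [h2]; exact h1
    obtain ⟨lam, hlam⟩ : ∃ lam : k[X], lam = C a⁻¹ * π.coeff 0 := ⟨_, rfl⟩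
    have hπfac : π = C (C a) * (X + C lam) := by
      have h3 : C (C a) * (X + C lam) = C (C a) * X + C (C a * lam) := by rw [mul_add, C_mul]
      rw [h3, hlam, ← mul_assoc, ← C_mul, mul_inv_cancel₀ ha0, C_1, one_mul, haC]
      exact hπeq
    refine ⟨a, lam, ha0, hπfac, ?_⟩
    have hcoef : (C a : k[X]) ^ μ * q.coeff 0 = C c := by rw [← hlc, ← haC]
    calc Φ = π ^ μ * q := hq
      _ = (C (C a) * (X + C lam)) ^ μ * C (q.coeff 0) := by rw [← hπfac, ← hqC]
      _ = C ((C a) ^ μ * q.coeff 0) * (X + C lam) ^ μ := by rw [C_mul, C_pow, mul_pow]; ring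
      _ = C (C c) * (X + C lam) ^ μ := by rw [hcoef]

/-- The constant term of a solvable face: `(c·(T + λ)^μ)_0 = c·λ^μ`. [folklore] -/
theorem coeff_zero_C_mul_X_add_C_pow (c : k) (lam : k[X]) (μ : ℕ) :
    ((C (C c) * (X + C lam) ^ μ : (k[X])[X])).coeff 0 = C c * lam ^ μ := by
  rw [coeff_C_mul, coeff_zero_eq_eval_zero, eval_pow, eval_add, eval_X, eval_C, zero_add]

/-- **`deg λ ≤ d` for a solvable face with the weight bound** `deg_u Φ_0 ≤ μ·d` (the face's constant term `C_0 = G_0(0,1,u)` has degree `≤ μδ`).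
[cite: CossartPiltant2008, Prop. 4.4 (proof, p. 11)] -/
theorem natDegree_le_of_solvableFace {Φ π : (k[X])[X]} {μ : ℕ} (hμ : 1 ≤ μ) (hdeg : Φ.natDegree ≤ μ) {c : k} (hc : c ≠ 0)
    (htop : Φ.coeff μ = C c) (hπ : ¬ IsUnit π) (hdvd : π ^ μ ∣ Φ) {d : ℕ} (hC0 : (Φ.coeff 0).natDegree ≤ μ * d) :
    ∃ (a : k) (lam : k[X]), a ≠ 0 ∧ π = C (C a) * (X + C lam) ∧ Φ = C (C c) * (X + C lam) ^ μ ∧ lam.natDegree ≤ d := by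
  obtain ⟨a, lam, ha, hπeq, hΦ⟩ := eq_C_mul_X_add_C_pow_of_pow_dvd hμ hdeg hc htop hπ hdvd
  refine ⟨a, lam, ha, hπeq, hΦ, natDegree_le_of_C_mul_pow_eq hc hμ ?_ hC0⟩
  rw [hΦ, coeff_zero_C_mul_X_add_C_pow]

end Summit.ResolutionOfSingularities.ResolutionOfSingularities.Theorems.RadicialJung.CleanModels

end
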